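import Summits.Schanuel.Schanuel.Theorems.DiophantineDichotomyApproximationPropertyElimCISpaceLemmas
import Summits.Schanuel.Schanuel.Theorems.DiophantineDichotomyApproximationPropertySpaceCIMacaulay
import Mathlib.Algebra.MvPolynomial.Funext
import Mathlib.LinearAlgebra.Basis.VectorSpace
import Mathlib.LinearAlgebra.FiniteDimensional.Lemmas
import HarnessLib

/-!
# The Hilbert-function lower bound for a prime space curve from its generic section (crux `ApproximationProperty`, stub `curveHilbert_lowerBound_of_genericSection`)

Crux `stmt-Schanuel-6117` (`Summit.Schanuel.Schanuel.Theses.DiophantineDichotomy.ApproximationProperty`),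
line `orbit-interpolation-determinant`; this file proves the registered stub
`curveHilbert_lowerBound_of_genericSection` (CONDITIONAL assembly; everything here is PROVED, no
definitions, no named facts): GIVEN the generic-section statement (registered neighbour
`curveHilbert_genericSection`, taken verbatim as a HYPOTHESIS), for `Q ≠ 0` a form of degree `a ≥ 1`
of `S = ℚ[x₀, …, x₃]` generating a prime ideal, `P ∉ (Q)` a form of degree `b ≥ 1` and a homogeneous
prime `𝔭 ∋ Q, P` with `dim S/𝔭 = 2`: `(ν - a - b) · ideg 𝔭 2 + dim 𝔭_ν ≤ dim S_ν` for `ν ≥ a + b`.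
Route: a rational hyperplane `ℓ = ∑ v_k x_k` with `g(v) ≠ 0` missing `𝔭` and the associated primes
of `S/(Q, P)` (finitely many proper subspaces and a hypersurface do not cover `ℚ⁴`; Macaulay, landed
`SpaceCI.*`); a linear non-zero-divisor `L` modulo `(Q, P, ℓ)`; `(Q, P, ℓ, L)_{s+1} = S_{s+1}` for
`s ≥ a + b + 1` (landed `ElimCISpace.hilbert_arith`), whence `H(𝔭 + (ℓ); ·)` is non-increasing
there; the `ideg 𝔭 2` section points are pairwise non-proportional common zeros of `𝔭 + (ℓ)`, so
`H(𝔭 + (ℓ); j) ≥ ideg 𝔭 2` for `j ≫ 0` (interpolation), hence for `j ≥ a + b + 1`; telescoping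
along `ℓ`. Sources: Philippon, Bull. SMF 114 (1986), Lemme 3.1; M. Chardin, Bull. SMF 117 (1989);
Nesterenko–Philippon (eds.), LNM 1752, Ch. 10 §3 and Ch. 11 §2.2.
-/

set_option linter.dupNamespace false

noncomputable section

namespace Summit.Schanuel.Schanuel.Cruxes.ApproximationProperty.OrbitInterpolationDeterminant

open Literature.NumberTheory.Transcendental.Nesterenko MvPolynomial Module
open Literature.RingTheory.MvPolynomial

namespace CurveHilbertLBOf

/-- For an ideal `𝔮` of `ℚ[x₀, …, x₃]` missing the variable `xᵢ` there is a polynomial `λ ≠ 0` in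
four variables with: `λ(v) ≠ 0` forces `∑ v_k x_k ∉ 𝔮` (the bad `v` form a proper subspace, inside
the kernel of a functional `f ≠ 0`; `λ = ∑ f(e_k) x_k`). [folklore] -/
theorem exists_poly_avoid {𝔮 : Ideal (Rx 3)} {i : Fin (3 + 1)} (hi : (X i : Rx 3) ∉ 𝔮) :
    ∃ lam : MvPolynomial (Fin (3 + 1)) ℚ, lam ≠ 0 ∧
      ∀ v : Fin (3 + 1) → ℚ, eval v lam ≠ 0 → (∑ k, C (v k) * X k : Rx 3) ∉ 𝔮 := by
  classical
  set lin : (Fin (3 + 1) → ℚ) →ₗ[ℚ] Rx 3 := Fintype.linearCombination ℚ fun k => (X k : Rx 3)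
    with hlin
  have hlin_apply : ∀ v : Fin (3 + 1) → ℚ, lin v = ∑ k, C (v k) * X k := fun v => by
    rw [hlin, Fintype.linearCombination_apply]; exact Finset.sum_congr rfl fun k _ => smul_eq_C_mul _ _
  set W : Submodule ℚ (Fin (3 + 1) → ℚ) := (Submodule.restrictScalars ℚ 𝔮).comap lin
  have hiW : (Pi.single i 1 : Fin (3 + 1) → ℚ) ∉ W := fun h => hi (by
    simpa [hlin] using (show lin (Pi.single i 1) ∈ Submodule.restrictScalars ℚ 𝔮 from h))
  obtain ⟨f, hfi, hWf⟩ := Submodule.exists_le_ker_of_notMem hiW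
  have heval : ∀ v : Fin (3 + 1) → ℚ, eval v (∑ k, C (f (Pi.single k 1)) * X k) = f v := by
    intro v
    conv_rhs => rw [pi_eq_sum_univ' v, map_sum]
    simp only [map_sum, map_mul, eval_C, eval_X, map_smul, smul_eq_mul]
    exact Finset.sum_congr rfl fun k _ => mul_comm _ _
  refine ⟨∑ k, C (f (Pi.single k 1)) * X k, fun h0 => hfi ?_, fun v hv hmem => ?_⟩
  · rw [← heval, h0, map_zero]
  · rw [heval] at hv
    exact hv (LinearMap.mem_ker.mp (hWf
      (show lin v ∈ Submodule.restrictScalars ℚ 𝔮 by rw [hlin_apply]; exact hmem)))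

/-- **A generic rational hyperplane avoiding finitely many ideals** (each missing a variable):
some `v ∈ ℚ⁴` has `g(v) ≠ 0` and `∑ v_k x_k` in no member of `𝓕` (`g · ∏ λ_𝔮 ≠ 0`). [folklore] -/
theorem exists_generic_v {g : MvPolynomial (Fin (3 + 1)) ℚ} (hg : g ≠ 0)
    (𝓕 : Finset (Ideal (Rx 3))) (h𝓕 : ∀ 𝔮 ∈ 𝓕, ∃ i, (X i : Rx 3) ∉ 𝔮) :
    ∃ v : Fin (3 + 1) → ℚ, eval v g ≠ 0 ∧ ∀ 𝔮 ∈ 𝓕, (∑ k, C (v k) * X k : Rx 3) ∉ 𝔮 := by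
  classical
  have hlam : ∀ 𝔮 : Ideal (Rx 3), ∃ lam : MvPolynomial (Fin (3 + 1)) ℚ, lam ≠ 0 ∧
      (𝔮 ∈ 𝓕 → ∀ v : Fin (3 + 1) → ℚ, eval v lam ≠ 0 → (∑ k, C (v k) * X k : Rx 3) ∉ 𝔮) := by
    intro 𝔮
    by_cases h𝔮 : 𝔮 ∈ 𝓕
    · obtain ⟨i, hi⟩ := h𝓕 𝔮 h𝔮
      obtain ⟨lam, h0, h⟩ := exists_poly_avoid hi
      exact ⟨lam, h0, fun _ => h⟩
    · exact ⟨1, one_ne_zero, fun h => (h𝔮 h).elim⟩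
  choose lam hlam0 hlam using hlam
  have hF : g * ∏ 𝔮 ∈ 𝓕, lam 𝔮 ≠ 0 :=
    mul_ne_zero hg (Finset.prod_ne_zero_iff.mpr fun 𝔮 _ => hlam0 𝔮)
  obtain ⟨v, hv⟩ : ∃ v : Fin (3 + 1) → ℚ, eval v (g * ∏ 𝔮 ∈ 𝓕, lam 𝔮) ≠ 0 := by
    by_contra h
    exact hF (MvPolynomial.funext fun v => by
      rw [map_zero]
      exact not_not.mp (not_exists.mp h v))
  rw [map_mul, map_prod] at hv
  exact ⟨v, left_ne_zero_of_mul hv, fun 𝔮 h𝔮 =>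
    hlam 𝔮 h𝔮 v (Finset.prod_ne_zero_iff.mp (right_ne_zero_of_mul hv) 𝔮 h𝔮)⟩

/-- A common zero `β` of `𝔭` with `∑ v_k β_k = 0` is a zero of `𝔭 + (∑ v_k x_k)`. [folklore] -/
theorem aeval_eq_zero_of_mem_sup {𝔭 : Ideal (Rx 3)} {v : Fin (3 + 1) → ℚ} {β : Fin (3 + 1) → ℂ}
    (h𝔭 : ∀ f ∈ 𝔭, aeval β f = 0) (hv : ∑ k, ((v k : ℚ) : ℂ) * β k = 0) :
    ∀ f ∈ 𝔭 ⊔ Ideal.span {(∑ k, C (v k) * X k : Rx 3)}, aeval β f = 0 := by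
  intro f hf
  obtain ⟨y, hy, z, hz, rfl⟩ := Submodule.mem_sup.mp hf
  obtain ⟨c, rfl⟩ := Ideal.mem_span_singleton'.mp hz
  rw [map_add, h𝔭 y hy, map_mul, show aeval β (∑ k, C (v k) * X k : Rx 3) = 0 by
    simpa only [map_sum, map_mul, aeval_C, aeval_X, eq_ratCast] using hv, mul_zero, add_zero]

section Zeros

variable {N : ℕ} (β : Fin N → (Fin (3 + 1) → ℂ))

/-- For pairwise non-proportional non-zero vectors `β₁, …, β_N` and `j + 1 ≥ N`, a complex form of
degree `j` vanishing at all `β_k`, `k ≠ i`, but not at `βᵢ`. [folklore] -/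
theorem exists_form_separating (hβ0 : ∀ i, β i ≠ 0)
    (hsep : ∀ i k, i ≠ k → ∃ p q, β i p * β k q ≠ β i q * β k p) {j : ℕ} (hj : N ≤ j + 1)
    (i : Fin N) :
    ∃ A : MvPolynomial (Fin (3 + 1)) ℂ, A.IsHomogeneous j ∧ eval (β i) A ≠ 0 ∧
      ∀ k, k ≠ i → eval (β k) A = 0 := by
  -- adapted from `CurveHilbert.exists_form_separating` (…CurveHilbertTelescope.lean)
  classical
  have hlin : ∀ (c : ℂ) (p : Fin (3 + 1)), (C c * X p : MvPolynomial (Fin (3 + 1)) ℂ).IsHomogeneous 1 :=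
    fun c p => by simpa using (isHomogeneous_C _ c).mul (isHomogeneous_X ℂ p)
  have hlam : ∀ k, ∃ lam : MvPolynomial (Fin (3 + 1)) ℂ, lam.IsHomogeneous 1 ∧
      (k ≠ i → eval (β i) lam ≠ 0 ∧ eval (β k) lam = 0) := by
    intro k
    by_cases hk : k = i
    · exact ⟨X 0, isHomogeneous_X ℂ 0, fun h => (h hk).elim⟩
    · obtain ⟨p, q, hpq⟩ := hsep i k (Ne.symm hk)
      refine ⟨C (β k q) * X p - C (β k p) * X q, (hlin _ p).sub (hlin _ q), fun _ => ⟨?_, ?_⟩⟩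
      · simp only [map_sub, map_mul, eval_C, eval_X]
        intro h
        apply hpq
        linear_combination h
      · simp only [map_sub, map_mul, eval_C, eval_X]
        ring
  choose lam hlam1 hlamv using hlam
  obtain ⟨c, hc⟩ := Function.ne_iff.mp (hβ0 i)
  have hN : 1 ≤ N := Nat.succ_le_of_lt i.pos
  refine ⟨(∏ k ∈ Finset.univ.erase i, lam k) * X c ^ (j + 1 - N), ?_, ?_, ?_⟩
  · have h1 : (∏ k ∈ Finset.univ.erase i, lam k).IsHomogeneous (∑ k ∈ Finset.univ.erase i, 1) :=
      IsHomogeneous.prod _ _ _ fun k _ => hlam1 k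
    rw [Finset.sum_const, smul_eq_mul, mul_one, Finset.card_erase_of_mem (Finset.mem_univ i),
      Finset.card_univ, Fintype.card_fin] at h1
    have h2 := h1.mul (isHomogeneous_X_pow (R := ℂ) c (j + 1 - N))
    rwa [show N - 1 + (j + 1 - N) = j by omega] at h2
  · rw [map_mul, map_pow, eval_X, map_prod]
    refine mul_ne_zero (Finset.prod_ne_zero_iff.mpr fun k hk => ?_) (pow_ne_zero _ hc)
    exact ((hlamv k) (Finset.ne_of_mem_erase hk)).1
  · intro k hk
    rw [map_mul, map_prod, Finset.prod_eq_zero (Finset.mem_erase.mpr ⟨hk, Finset.mem_univ k⟩)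
      ((hlamv k) hk).2, zero_mul]

/-- **`N` non-zero pairwise non-proportional common zeros of an ideal `J ⊆ ℚ[x₀, …, x₃]` give
`dim S_j − dim J_j ≥ N` for `j + 1 ≥ N`** (the evaluation map `S_j → ℂ^N` kills `J_j`, and the
`ℂ`-span of its image is everything). [cite: Chardin1989, §1 (interpolation on finite sets)] -/
theorem le_hilbert_of_zeros (J : Ideal (Rx 3)) (hβ0 : ∀ i, β i ≠ 0)
    (hsep : ∀ i k, i ≠ k → ∃ p q, β i p * β k q ≠ β i q * β k p)
    (hzero : ∀ i, ∀ f ∈ J, aeval (β i) f = 0) {j : ℕ} (hj : N ≤ j + 1) :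
    N ≤ finrank ℚ (homogeneousSubmodule (Fin (3 + 1)) ℚ j) - finrank ℚ (idealDegree J j) := by
  -- adapted from `CurveHilbert.le_hilbert_of_zeros` (…CurveHilbertTelescope.lean)
  classical
  set V : Submodule ℚ (Rx 3) := homogeneousSubmodule (Fin (3 + 1)) ℚ j
  haveI : Module.Finite ℚ V := finite_homogeneousSubmodule (K := ℚ) (σ := Fin (3 + 1)) j
  let ev : Rx 3 →ₗ[ℚ] (Fin N → ℂ) :=
    LinearMap.pi fun i => ((aeval (β i) : Rx 3 →ₐ[ℚ] ℂ).toLinearMap)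
  have ev_apply : ∀ (f : Rx 3) (i : Fin N), ev f i = aeval (β i) f := fun f i => rfl
  let evV : V →ₗ[ℚ] (Fin N → ℂ) := ev.comp V.subtype
  have hker : (idealDegree J j).comap V.subtype ≤ LinearMap.ker evV := fun x hx =>
    LinearMap.mem_ker.mpr (funext fun i => hzero i x.1 (mem_idealDegree.mp hx).1)
  have hk : finrank ℚ (idealDegree J j) ≤ finrank ℚ (LinearMap.ker evV) := by
    rw [← (Submodule.comapSubtypeEquivOfLe (idealDegree_le_homogeneousSubmodule J j)).finrank_eq]
    exact Submodule.finrank_mono hker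
  have hrn := LinearMap.finrank_range_add_finrank_ker evV
  set Rg : Submodule ℚ (Fin N → ℂ) := LinearMap.range evV
  set S : Submodule ℂ (Fin N → ℂ) := Submodule.span ℂ (Rg : Set (Fin N → ℂ))
  -- `dim_ℂ S ≤ dim_ℚ Rg`
  have hS_le : finrank ℂ S ≤ finrank ℚ Rg := by
    let b := Module.finBasis ℚ Rg
    have hsub : (Rg : Set (Fin N → ℂ)) ⊆ Submodule.span ℂ (Set.range fun i => (b i : Fin N → ℂ)) := by
      intro x hx
      have hx' : x = ∑ i, ((b.repr ⟨x, hx⟩ i : ℚ) : ℂ) • (b i : Fin N → ℂ) := by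
        have := congrArg Subtype.val (b.sum_repr ⟨x, hx⟩).symm
        simp only [Submodule.coe_sum, Submodule.coe_smul] at this
        exact this.trans (Finset.sum_congr rfl fun i _ => _root_.funext fun k => by simp [Rat.smul_def])
      rw [hx']
      exact Submodule.sum_mem _ fun i _ => Submodule.smul_mem _ _ (Submodule.subset_span ⟨i, rfl⟩)
    exact (Submodule.finrank_mono (Submodule.span_le.mpr hsub)).trans
      ((finrank_range_le_card _).trans_eq (Fintype.card_fin _))
  -- `S = ⊤`: complex forms of degree `j` evaluate into `S`, and they separate the points
  have hmono : ∀ d : Fin (3 + 1) →₀ ℕ, (monomial d (1 : ℚ) : Rx 3) ∈ V →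
      (fun i => eval (β i) (monomial d (1 : ℂ))) ∈ S := by
    intro d hd
    have heq : (fun i => eval (β i) (monomial d (1 : ℂ))) = ev (monomial d (1 : ℚ)) := by
      funext i
      rw [ev_apply, aeval_def, ← eval_map, map_monomial, RingHom.map_one]
    rw [heq]
    exact Submodule.subset_span ⟨⟨monomial d 1, hd⟩, rfl⟩
  have hformS : ∀ G : MvPolynomial (Fin (3 + 1)) ℂ, G.IsHomogeneous j →
      (fun i => eval (β i) G) ∈ S := by
    intro G hG
    have hGsum : (fun i => eval (β i) G) =
        ∑ d ∈ G.support, coeff d G • fun i => eval (β i) (monomial d (1 : ℂ)) := by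
      funext i
      conv_lhs => rw [G.as_sum, map_sum]
      simp only [Finset.sum_apply, Pi.smul_apply, smul_eq_mul]
      refine Finset.sum_congr rfl fun d _ => ?_
      rw [show monomial d (coeff d G) = C (coeff d G) * monomial d 1 by
        rw [C_mul_monomial, mul_one], map_mul, eval_C]
    rw [hGsum]
    refine Submodule.sum_mem _ fun d hd => Submodule.smul_mem _ _ (hmono d ?_)
    exact isHomogeneous_monomial _
      (by rw [Finsupp.degree_eq_weight_one]; exact hG (mem_support_iff.mp hd))
  have htop : (⊤ : Submodule ℂ (Fin N → ℂ)) ≤ S := by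
    have hsingle : ∀ i, (Pi.single i 1 : Fin N → ℂ) ∈ S := by
      intro i
      obtain ⟨A, hA, hAi, hAk⟩ := exists_form_separating β hβ0 hsep hj i
      have hmem := Submodule.smul_mem S (eval (β i) A)⁻¹ (hformS A hA)
      have heq : (eval (β i) A)⁻¹ • (fun k => eval (β k) A) = Pi.single i 1 := by
        funext k
        by_cases hki : k = i
        · subst hki
          simp [hAi]
        · simp [hAk k hki, hki]
      rwa [heq] at hmem
    intro x _
    rw [pi_eq_sum_univ' x]
    exact Submodule.sum_mem _ fun i _ => Submodule.smul_mem _ _ (hsingle i)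
  have hS_ge : N ≤ finrank ℂ S := by
    have h := Submodule.finrank_mono htop
    rwa [finrank_top, Module.finrank_fin_fun] at h
  have h1 : N + finrank ℚ (idealDegree J j) ≤ finrank ℚ V :=
    calc N + finrank ℚ (idealDegree J j) ≤ finrank ℚ Rg + finrank ℚ (LinearMap.ker evV) :=
          add_le_add (hS_ge.trans hS_le) hk
      _ = finrank ℚ V := hrn
  exact Nat.le_sub_of_add_le h1

end Zeros

/-- **`H(K₂; n) ≥ D` for `n ≥ a + b + 1`**, for `(Q, P)` a space complete intersection of type
`(a, b)`, `ℓ ≠ 0` / `L ≠ 0` linear non-zero-divisors modulo `(Q, P)` / `(Q, P, ℓ)`, and `K₂ ⊇ (Q, P, ℓ)`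
homogeneous with `D` non-zero pairwise non-proportional common zeros: `(Q, P, ℓ, L)_{s+1} = S_{s+1}`
for `s ≥ a + b + 1` makes `·L : (S/K₂)_s → (S/K₂)_{s+1}` onto, so `H(K₂; ·)` is non-increasing there,
and `H(K₂; j) ≥ D` for `j + 1 ≥ D` by interpolation. [cite: Philippon1986, Lemme 3.1] -/
theorem section_ge {Q P ℓ L : Rx 3} {a b : ℕ} (hQ0 : Q ≠ 0)
    (hQ : Q.IsHomogeneous a) (hP : P.IsHomogeneous b)
    (hprime : (Ideal.span {Q}).IsPrime) (hPQ : P ∉ Ideal.span {Q})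
    (hℓ1 : ℓ.IsHomogeneous 1) (hℓ0 : ℓ ≠ 0)
    (hℓnzd : ∀ f, ℓ * f ∈ Ideal.span {Q} ⊔ Ideal.span {P} → f ∈ Ideal.span {Q} ⊔ Ideal.span {P})
    (hL1 : L.IsHomogeneous 1) (hL0 : L ≠ 0)
    (hLnzd : ∀ f, L * f ∈ Ideal.span {Q} ⊔ Ideal.span {P} ⊔ Ideal.span {ℓ} →
      f ∈ Ideal.span {Q} ⊔ Ideal.span {P} ⊔ Ideal.span {ℓ})
    {K₂ : Ideal (Rx 3)} (hK₂ : letI := MvPolynomial.gradedAlgebra (σ := Fin (3 + 1)) (R := ℚ)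
      K₂.IsHomogeneous (homogeneousSubmodule (Fin (3 + 1)) ℚ))
    (hle : Ideal.span {Q} ⊔ Ideal.span {P} ⊔ Ideal.span {ℓ} ≤ K₂)
    {D : ℕ} {β : Fin D → (Fin (3 + 1) → ℂ)} (hβ0 : ∀ i, β i ≠ 0)
    (hsep : ∀ i k, i ≠ k → ∃ p q, β i p * β k q ≠ β i q * β k p)
    (hzero : ∀ i, ∀ f ∈ K₂, aeval (β i) f = 0) {n : ℕ} (hn : a + b + 1 ≤ n) :
    D ≤ finrank ℚ (homogeneousSubmodule (Fin (3 + 1)) ℚ n) - finrank ℚ (idealDegree K₂ n) := by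
  letI : GradedAlgebra (homogeneousSubmodule (Fin (3 + 1)) ℚ) := MvPolynomial.gradedAlgebra
  -- section numerics adapted from `CurveHilbert.idealDegree_QPlL_eq` (…CurveHilbertSection.lean)
  have hQhom := SpaceCI.isHomogeneous_span hQ
  have hJhom : (Ideal.span {Q} ⊔ Ideal.span {P}).IsHomogeneous
      (homogeneousSubmodule (Fin (3 + 1)) ℚ) := hQhom.sup (SpaceCI.isHomogeneous_span hP)
  have hIhom : (Ideal.span {Q} ⊔ Ideal.span {P} ⊔ Ideal.span {ℓ}).IsHomogeneous
      (homogeneousSubmodule (Fin (3 + 1)) ℚ) := hJhom.sup (SpaceCI.isHomogeneous_span hℓ1)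
  have hnzdQ : ∀ f, Q * f ∈ (⊥ : Ideal (Rx 3)) → f ∈ (⊥ : Ideal (Rx 3)) := fun f hf =>
    Ideal.mem_bot.mpr ((mul_eq_zero.mp (Ideal.mem_bot.mp hf)).resolve_left hQ0)
  have hnzdP : ∀ f, P * f ∈ Ideal.span {Q} → f ∈ Ideal.span {Q} := fun f hf =>
    (hprime.mem_or_mem hf).resolve_left hPQ
  set d : ℕ → ℕ := fun n => finrank ℚ (homogeneousSubmodule (Fin (3 + 1)) ℚ n)
  set q : ℕ → ℕ := fun n => finrank ℚ (idealDegree (Ideal.span {Q}) n)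
  set j : ℕ → ℕ := fun n => finrank ℚ (idealDegree (Ideal.span {Q} ⊔ Ideal.span {P}) n)
  set k : ℕ → ℕ := fun n =>
    finrank ℚ (idealDegree (Ideal.span {Q} ⊔ Ideal.span {P} ⊔ Ideal.span {ℓ}) n)
  set kl : ℕ → ℕ := fun n => finrank ℚ
    (idealDegree (Ideal.span {Q} ⊔ Ideal.span {P} ⊔ Ideal.span {ℓ} ⊔ Ideal.span {L}) n)
  set k₂ : ℕ → ℕ := fun n => finrank ℚ (idealDegree K₂ n)
  set kL : ℕ → ℕ := fun n => finrank ℚ (idealDegree (K₂ ⊔ Ideal.span {L}) n)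
  have Hq : ∀ t n, n = t + a → q n = d t := by
    rintro t n rfl
    have h := finrank_idealDegree_sup_span_add_eq (Ideal.IsHomogeneous.bot _) hQ0 hQ hnzdQ t
    rw [bot_sup_eq, idealDegree_bot, idealDegree_bot, finrank_bot] at h
    simpa using h
  have Hj : ∀ t n, n = t + b → j n + q t = q n + d t := by
    rintro t n rfl
    exact finrank_idealDegree_sup_span_add_eq hQhom (SpaceCI.ne_zero_of_notMem hPQ) hP hnzdP t
  have Hk : ∀ t n, n = t + 1 → k n + j t = j n + d t := by
    rintro t n rfl
    exact finrank_idealDegree_sup_span_add_eq hJhom hℓ0 hℓ1 hℓnzd t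
  have Hkl : ∀ s, kl (s + 1) + k s = k (s + 1) + d s := fun s =>
    finrank_idealDegree_sup_span_add_eq hIhom hL0 hL1 hLnzd s
  have Hstep : ∀ s, a + b + 1 ≤ s → d (s + 1) + k₂ s ≤ k₂ (s + 1) + d s := by
    intro s hs
    have hf : kl (s + 1) = d (s + 1) :=
      ElimCISpace.hilbert_arith hs ElimCISpace.finrank_homogeneousSubmodule_succ Hq Hj Hk (Hkl s)
    have h : kL (s + 1) + k₂ s ≤ k₂ (s + 1) + d s := finrank_idealDegree_sup_span_add_le hK₂ hL0 hL1 s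
    have hmono : kl (s + 1) ≤ kL (s + 1) := finrank_idealDegree_mono (sup_le_sup_right hle _) _
    have hle' : kL (s + 1) ≤ d (s + 1) := finrank_idealDegree_le (K₂ ⊔ Ideal.span {L}) (s + 1)
    omega
  have Hmono : ∀ w, d (n + w) + k₂ n ≤ k₂ (n + w) + d n := by
    intro w
    induction w with
    | zero => simp only [Nat.add_zero, add_comm, le_refl]
    | succ w ih =>
      have h := Hstep (n + w) (by omega)
      rw [show n + (w + 1) = n + w + 1 by ring]
      omega
  have HD : D ≤ d (n + D) - k₂ (n + D) := le_hilbert_of_zeros β K₂ hβ0 hsep hzero (by omega)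
  have h1 := Hmono D
  have h2 : k₂ (n + D) ≤ d (n + D) := finrank_idealDegree_le K₂ (n + D)
  change D ≤ d n - k₂ n
  omega

/-- **The curve Hilbert-function lower bound from the generic section** (curried form of the
registered stub): `(ν − a − b) · ideg 𝔭 2 + dim 𝔭_ν ≤ dim S_ν`, `ν ≥ a + b`. [cite: Philippon1986, Lemme 3.1] -/
theorem lowerBound
    (hGS : ∀ (m : ℕ) (𝔭 : Ideal (Rx m)), 𝔭.IsPrime →
      (letI := MvPolynomial.gradedAlgebra (σ := Fin (m + 1)) (R := ℚ);
        𝔭.IsHomogeneous (MvPolynomial.homogeneousSubmodule (Fin (m + 1)) ℚ)) →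
      ringKrullDim (Rx m ⧸ 𝔭) = (2 : ℕ) →
      ∃ g : MvPolynomial (Fin (m + 1)) ℚ, g ≠ 0 ∧ ∀ v : Fin (m + 1) → ℚ,
        MvPolynomial.eval v g ≠ 0 →
        ∃ β : Fin (Literature.NumberTheory.Transcendental.Nesterenko.ideg 𝔭 2) → (Fin (m + 1) → ℂ),
          (∀ i, β i ∈ Literature.NumberTheory.Transcendental.Nesterenko.projZeros 𝔭) ∧
          (∀ i, ∑ k, ((v k : ℚ) : ℂ) * β i k = 0) ∧
          ∀ i k, i ≠ k → ∃ p q, β i p * β k q ≠ β i q * β k p)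
    {Q P : Rx 3} {a b : ℕ} (hQ0 : Q ≠ 0) (hQ : Q.IsHomogeneous a) (hP : P.IsHomogeneous b)
    (ha : 1 ≤ a) (hb : 1 ≤ b) (hprime : (Ideal.span {Q}).IsPrime) (hPQ : P ∉ Ideal.span {Q})
    {𝔭 : Ideal (Rx 3)} (h𝔭 : 𝔭.IsPrime) (h𝔭hom : letI := MvPolynomial.gradedAlgebra (σ := Fin (3 + 1)) (R := ℚ)
      𝔭.IsHomogeneous (homogeneousSubmodule (Fin (3 + 1)) ℚ))
    (hQ𝔭 : Q ∈ 𝔭) (hP𝔭 : P ∈ 𝔭) (hdim : ringKrullDim (Rx 3 ⧸ 𝔭) = (2 : ℕ)) {ν : ℕ}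
    (hν : a + b ≤ ν) :
    (ν - a - b) * ideg 𝔭 2 + finrank ℚ (idealDegree 𝔭 ν) ≤
      finrank ℚ (homogeneousSubmodule (Fin (3 + 1)) ℚ ν) := by
  classical
  letI : GradedAlgebra (homogeneousSubmodule (Fin (3 + 1)) ℚ) := MvPolynomial.gradedAlgebra
  obtain ⟨g, hg0, hg⟩ := hGS 3 𝔭 h𝔭 h𝔭hom hdim
  have hfin := associatedPrimes.finite (Rx 3) (Rx 3 ⧸ (Ideal.span {Q} ⊔ Ideal.span {P}))
  have h𝓕 : ∀ 𝔮 ∈ insert 𝔭 hfin.toFinset, ∃ i, (X i : Rx 3) ∉ 𝔮 := by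
    intro 𝔮 h𝔮
    obtain ⟨h1, h2⟩ : 𝔮.IsPrime ∧ ringKrullDim (Rx 3 ⧸ 𝔮) ≠ 0 := by
      rcases Finset.mem_insert.mp h𝔮 with rfl | h𝔮
      · exact ⟨h𝔭, by rw [hdim]; norm_num⟩
      · have h𝔯 := hfin.mem_toFinset.mp h𝔮
        exact ⟨IsAssociatedPrime.isPrime h𝔯, by
          rw [SpaceCI.ringKrullDim_quotient_eq_two hQ0 hQ hP ha hb hprime hPQ h𝔯]; norm_num⟩
    exact exists_X_notMem_of_ringKrullDim_ne_zero h2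
  obtain ⟨v, hvg, hv⟩ := exists_generic_v hg0 _ h𝓕
  obtain ⟨β, hβV, hβℓ, hβsep⟩ := hg v hvg
  have hzero : ∀ i, ∀ f ∈ 𝔭 ⊔ Ideal.span {(∑ k, C (v k) * X k : Rx 3)}, aeval (β i) f = 0 :=
    fun i => aeval_eq_zero_of_mem_sup (fun f hf => (hβV i).2 f hf) (hβℓ i)
  set ℓ : Rx 3 := ∑ k, C (v k) * X k
  have hℓ𝔭 : ℓ ∉ 𝔭 := hv 𝔭 (Finset.mem_insert_self _ _)
  have hℓ1 : ℓ.IsHomogeneous 1 := IsHomogeneous.sum _ _ _ fun k _ => by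
    simpa using (isHomogeneous_C _ (v k)).mul (isHomogeneous_X ℚ k)
  have hℓ0 : ℓ ≠ 0 := fun h => hℓ𝔭 (h ▸ 𝔭.zero_mem)
  have hℓnzd : ∀ f, ℓ * f ∈ Ideal.span {Q} ⊔ Ideal.span {P} → f ∈ Ideal.span {Q} ⊔ Ideal.span {P} :=
    SpaceCI.nzd_of_forall_notMem fun 𝔯 h𝔯 => hv 𝔯 (Finset.mem_insert_of_mem (hfin.mem_toFinset.mpr h𝔯))
  have hnzd𝔭 : ∀ f, ℓ * f ∈ 𝔭 → f ∈ 𝔭 := fun f hf => (h𝔭.mem_or_mem hf).resolve_left hℓ𝔭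
  have hAss1 : ∀ 𝔯 ∈ associatedPrimes (Rx 3)
      (Rx 3 ⧸ (Ideal.span {Q} ⊔ Ideal.span {P} ⊔ Ideal.span {ℓ})), ringKrullDim (Rx 3 ⧸ 𝔯) ≠ 0 :=
    fun 𝔯 h𝔯 => by
      rw [SpaceCI.ringKrullDim_quotient_eq_one hQ0 hQ hP hℓ1 ha hb le_rfl hprime hPQ hℓnzd h𝔯]
      norm_num
  obtain ⟨L, hL1, hL0, -, hLnzd⟩ := SpaceCI.exists_linear_nzd hAss1 ∅ (by simp)
  have hle : Ideal.span {Q} ⊔ Ideal.span {P} ⊔ Ideal.span {ℓ} ≤ 𝔭 ⊔ Ideal.span {ℓ} :=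
    sup_le (sup_le ((Ideal.span_singleton_le_iff_mem _).mpr hQ𝔭)
      ((Ideal.span_singleton_le_iff_mem _).mpr hP𝔭) |>.trans le_sup_left) le_sup_right
  have hK₂ : (𝔭 ⊔ Ideal.span {ℓ}).IsHomogeneous (homogeneousSubmodule (Fin (3 + 1)) ℚ) :=
    h𝔭hom.sup (SpaceCI.isHomogeneous_span hℓ1)
  -- `H(𝔭; n + 1) = H(𝔭; n) + H(𝔭 + (ℓ); n + 1) ≥ H(𝔭; n) + ideg 𝔭 2` for `n ≥ a + b`; induction on `ν`
  set d : ℕ → ℕ := fun n => finrank ℚ (homogeneousSubmodule (Fin (3 + 1)) ℚ n)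
  set p : ℕ → ℕ := fun n => finrank ℚ (idealDegree 𝔭 n)
  set k₂ : ℕ → ℕ := fun n => finrank ℚ (idealDegree (𝔭 ⊔ Ideal.span {ℓ}) n)
  have Hsec : ∀ n, a + b + 1 ≤ n → ideg 𝔭 2 ≤ d n - k₂ n := fun n hn =>
    section_ge hQ0 hQ hP hprime hPQ hℓ1 hℓ0 hℓnzd hL1 hL0 hLnzd hK₂ hle (fun i => (hβV i).1)
      hβsep hzero hn
  have Hcut : ∀ t, (d (t + 1) - k₂ (t + 1)) + (d t - p t) = d (t + 1) - p (t + 1) := fun t =>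
    hilbert_sup_span_add_hilbert_eq h𝔭hom hℓ0 hℓ1 hnzd𝔭 t
  have hpd : ∀ n, p n ≤ d n := fun n => finrank_idealDegree_le 𝔭 n
  obtain ⟨w, rfl⟩ := Nat.exists_eq_add_of_le hν
  change (a + b + w - a - b) * ideg 𝔭 2 + p (a + b + w) ≤ d (a + b + w)
  rw [show a + b + w - a - b = w by omega]
  induction w with
  | zero => simpa using hpd (a + b)
  | succ w ih =>
    have h1 := Hcut (a + b + w)
    have h2 := Hsec (a + b + w + 1) (by omega)
    have h3 := hpd (a + b + w + 1)
    rw [show a + b + (w + 1) = a + b + w + 1 by ring, Nat.succ_mul]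
    omega

end CurveHilbertLBOf

/-- **Registered stub `curveHilbert_lowerBound_of_genericSection`** (line
`orbit-interpolation-determinant`): the generic-section statement implies the curve Hilbert-function
lower bound `(ν − a − b) · ideg 𝔭 2 + dim 𝔭_ν ≤ dim S_ν` (= `CurveHilbertLBOf.lowerBound`).
[cite: Philippon1986, Lemme 3.1] -/
theorem curveHilbert_lowerBound_of_genericSection : (∀ (m : ℕ) (𝔭 : Ideal (Rx m)), 𝔭.IsPrime → (letI := MvPolynomial.gradedAlgebra (σ := Fin (m + 1)) (R := ℚ); 𝔭.IsHomogeneous (MvPolynomial.homogeneousSubmodule (Fin (m + 1)) ℚ)) → ringKrullDim (Rx m ⧸ 𝔭) = (2 : ℕ) → ∃ g : MvPolynomial (Fin (m + 1)) ℚ, g ≠ 0 ∧ ∀ v : Fin (m + 1) → ℚ, MvPolynomial.eval v g ≠ 0 → ∃ β : Fin (Literature.NumberTheory.Transcendental.Nesterenko.ideg 𝔭 2) → (Fin (m + 1) → ℂ), (∀ i, β i ∈ Literature.NumberTheory.Transcendental.Nesterenko.projZeros 𝔭) ∧ (∀ i, ∑ k, ((v k : ℚ) : ℂ) * β i k = 0)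 ∧ ∀ i k, i ≠ k → ∃ p q, β i p * β k q ≠ β i q * β k p) → ∀ (Q P : Rx 3) (a b : ℕ), Q ≠ 0 → Q.IsHomogeneous a → P.IsHomogeneous b → 1 ≤ a → 1 ≤ b → (Ideal.span {Q}).IsPrime → P ∉ Ideal.span {Q} → ∀ 𝔭 : Ideal (Rx 3), 𝔭.IsPrime → (letI := MvPolynomial.gradedAlgebra (σ := Fin (3 + 1)) (R := ℚ); 𝔭.IsHomogeneous (MvPolynomial.homogeneousSubmodule (Fin (3 + 1)) ℚ)) → Q ∈ 𝔭 → P ∈ 𝔭 → ringKrullDim (Rx 3 ⧸ 𝔭) = (2 : ℕ) → ∀ ν : ℕ, a + b ≤ ν → (ν - a - b) * Literature.NumberTheory.Transcendental.Nesterenko.ideg 𝔭 2 + Module.finrank ℚ ↥(Literature.RingTheory.MvPolynomial.idealDegree 𝔭 ν) ≤ Module.finrank ℚ ↥(MvPolynomial.homogeneousSubmodule (Fin (3 + 1)) ℚ ν) := by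
  intro hGS Q P a b hQ0 hQ hP ha hb hprime hPQ 𝔭 h𝔭 h𝔭hom hQ𝔭 hP𝔭 hdim ν hν
  exact CurveHilbertLBOf.lowerBound hGS hQ0 hQ hP ha hb hprime hPQ h𝔭 h𝔭hom hQ𝔭 hP𝔭 hdim hν

end Summit.Schanuel.Schanuel.Cruxes.ApproximationProperty.OrbitInterpolationDeterminant

end
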